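import Literature.IUT.HodgeTheaters.InitialThetaDataTorsionMonodromyModelProofs
import HarnessLib

/-!
# [IUTchI] Def 3.1 (c)(d) / [EtTh] Def 2.1 / Def 6.1 (v): the `l`-torsion monodromy KILLS THE CUSP INERTIA — the
# v-next law `tau_inertia` (GAP-LEDGER G-L5d5g6-1) HOLDS at the re-geometrised semidirect model (NV-L5 witness
# «tau_inertia-NV»; proof-only companion of `…TorsionMonodromyModel{,KLevel,Geometry,Proofs}.lean`)

S. Mochizuki, *Inter-universal Teichmüller theory I*, kurims manuscript (May 2020), §1 p. 37 l. 30–36 «natural exact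
sequence `1 → I_{ε′} × I_{ε″} → Δ_ε → Δ_E ⊗ (ℤ/lℤ) → 1` … the inertia groups», §3 Definition 3.1 (d) p. 62 «`X̲_K`
of type `(1, l-tors)` [cf. [EtTh], Definition 2.1]» (where [EtTh] Def 2.1 p. 36: «a quotient onto a free
`(ℤ/lℤ)`-module `Q` of rank `1` such that the restricted map `Δ̄^ell_X → Q` is still surjective, but the restricted
map `D_x → Q` is trivial»), §6 Definition 6.1 (v) p. 158 «from the Galois action on `Δ_X^{ab} ⊗ 𝔽_l` … the rank
one quotient of `Δ_X^{ab} ⊗ 𝔽_l` that gives rise to the covering `X̲_K → X_K`», and Corollary 1.2 proof p. 39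
«`Π_X̲ = Π_{X→} · H`, `H := Ker(Δ_X ↠ Δ_X^{ab} ⊗ ℤ/l)`» [cite: Mochizuki2012, IUTchI §1 p.37; Def 3.1(d) p.62;
Def 6.1(v) p.158; Cor 1.2 p.39] (D-0012 claim key; series status DISPUTED — this file is finite group theory
about the cell's own MODEL of its `π₁`-interface structures; nothing of the series is asserted; no side is taken
on [IUTchIII] Cor. 3.12).

## WHY (abc-iut-L5-lead gen 6 RULINGS #60 (1), #63 (3); GAP-LEDGER G-L5d5g6-1; WAKE «LocalArrowLaw-NV» (A))

abc-iut-L5-d5's `InitialThetaData.TorsionMonodromy.localArrowLaw_L1_of_torsionMonodromy` /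
`…localArrowLaw_L1_local` (`PiAvatarLocalArrowLawL1OfTorsionMonodromy.lean`, p445209) derive the local arrow law
(L1) of abc-iut-L5-t4's `LocalArrowLaw` from `M : D.TorsionMonodromy` (abc-iut-L5-t8, p433356), the §1 claims
`hA : D.geom.pe.ArrowCoveringClaims`, and ONE explicit named binder
**`hI : ∀ k ∈ D.geom.pe.inertia D.geom.pe.ε1, M.tau (D.geom.embK k) = 0`** — «the cusp inertia of `X` dies in
`Δ_X^{ab} ⊗ 𝔽_l = E[l]`» (`[l] : E → E` is étale over the origin; `Δ_X ≅ F̂₂` with the puncture class a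
commutator), a (rel)-type classical law the v1 datum `TorsionMonodromy` does not record.  GAP row G-L5d5g6-1 asks
the abc-iut-L5-t8 lineage for the v-next FIELD
`tau_inertia : ∀ x : D.geom.pe.Cusp, ∀ k ∈ D.geom.pe.inertia x, tau (D.geom.embK k) = 0`
and for its NON-VACUITY at the lineage's semidirect model (p441125 / p441518 / p441785 / p441849).

## WHAT (proof-only; 0 `def`, no `instance`, no notation, no new `Prop` fact)

For EVERY initial Θ-datum `D₀` and its re-geometrisation `D₀.regeom` (abc-iut-L5-t8 gen 6: `Π_{C_F} := E_F[l](F̄)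
⋊ (G_F × {±1})`, `Π_{C_K} = G_K × (E_F[l] ⋊ {±1})`, §1 datum `pe = pedOf G_K g`, monodromy term
`torsionMonodromyRegeom D₀` with `τ ⟨t, (σ, u)⟩ = t`):
* `TorsionMonodromyModel.pedOf_inertia_eq_bot` / `InitialThetaData.inertia_regeom_eq_bot` — in the model the cusp
  inertia groups `I_x = D_x ∩ Δ_C` are TRIVIAL (`D_x := G_K × 1` and `Δ_C = 1 × (E_F[l] ⋊ {±1})`);
* **`InitialThetaData.tau_regeom_embK_eq_zero_of_mem_inertia`** — the law `tau_inertia` HOLDS at the model for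
  every cusp `x`; `InitialThetaData.tau_regeom_inertia_ε1` — abc-iut-L5-d5's binder `hI`, verbatim, at the model;
* `InitialThetaData.exists_torsionMonodromy_tau_inertia`, `…exists_initialThetaData_torsionMonodromy_tau_inertia` —
  the binder pair `{M : D.TorsionMonodromy, tau_inertia M}` is JOINTLY satisfiable at `D₀.regeom` (same `V^bad_mod`,
  same `V̲` as `D₀`): NV-L5 register evidence for G-L5d5g6-1;
* `InitialThetaData.isLocallyConstant_tau_regeom` — the model's `τ` is locally constant (continuity of `τ`, the
  other half of the «(rel) + continuity ⇒ hI» route noted by abc-iut-L5-d5, also holds in the model);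
* HONEST LIMIT, kernel-visible: `PuncturedEllipticData.not_arrowCoveringClaims_of_inertia_ε1_eq_bot` (the printed
  §1 claims `I_{ε′} ⊔ jKer = Δ_X̲`, `[Δ_X̲ : jKer] = l ≥ 5` force `I_{ε′} ≠ 1`) and
  `InitialThetaData.not_arrowCoveringClaims_regeom` — the re-geometrised model does NOT satisfy
  `ArrowCoveringClaims`, so it witnesses `{M, hI}` jointly but NOT `{M, hA, hI}` (abc-iut-L5-t1's `ArrowModel` files
  witness `hA` separately; a joint model needs nontrivial cusp inertia and is not claimed here).

HONEST LABEL «[model; degenerate at the inertia]»: the witness is the lineage's MODEL of the interface, in which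
`Δ_X = E_F[l](F̄)` is finite and the cusp decomposition groups are the synthetic `G_K × 1`, so `tau_inertia` holds
there because the inertia groups vanish — CONSISTENCY evidence for the binder pair `{M, hI}` / the v-next field,
not a discharge of `hI` at the genuine curve (that is the classical fact «inertia ⊆ closure of commutators of
`Δ_X ≅ F̂₂`» plus continuity of `τ`, plan/FOUNDATIONS.md row 12).  Model ≠ genuine datum; inhabited ≠ discharged;
typed ≠ proved; nothing here bears on [IUTchIII] Cor. 3.12.
-/

noncomputable section

namespace Literature.IUT.HodgeTheaters

universe u

open scoped WeierstrassCurve.Affine Classical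

/-! ## A general §1 fact: the printed claims of p. 38 force nontrivial inertia at `ε′` -/

namespace PuncturedEllipticData

/-- If the inertia group `I_{ε′}` of the §1 datum is trivial, the printed claims of [IUTchI] §1 p. 38 FAIL:
`I_{ε′} ⊔ jKer = Δ_X̲` would give `jKer = Δ_X̲`, contradicting `[Δ_X̲ : jKer] = l ≥ 5` («`I_{ε′} ⥲ Δ_ε⁺`», rank one).
Used below to record honestly that the semidirect model is not a witness of `ArrowCoveringClaims`.
[cite: Mochizuki2012, IUTchI §1 p.38] -/
theorem not_arrowCoveringClaims_of_inertia_ε1_eq_bot (D : PuncturedEllipticData.{u}) (h : D.inertia D.ε1 = ⊥) :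
    ¬ D.ArrowCoveringClaims := by
  intro hA
  have h1 : D.jKer = D.DeltaXbar := by
    have := hA.inertia_ε1_sup
    rwa [h, bot_sup_eq] at this
  have h2 : D.jKer.relIndex D.DeltaXbar = D.l := hA.jKer_relindex
  rw [h1, Subgroup.relIndex_self] at h2
  have h5 : 5 ≤ D.l := D.five_le
  omega

end PuncturedEllipticData

/-! ## The `K`-level model `pedOf G g`: decomposition groups `G × 1`, inertia groups trivial -/

namespace TorsionMonodromyModel

open Literature.AnabelianGeometry.AbsoluteAnabelian

variable {F : Type u} [Field F] {E : WeierstrassCurve F} {Fbar : Type u} [Field Fbar] [Algebra F Fbar] {l : ℕ}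
  (G : Type u) [Group G] [TopologicalSpace G] [IsTopologicalGroup G] [CompactSpace G] [TotallyDisconnectedSpace G]
  [E.IsElliptic] [NeZero l]

/-- The representative decomposition group of every cusp of the `K`-level model is `G × 1` (by definition of
`pedOf`). [cite: Mochizuki2012, IUTchI §1 p.37] -/
theorem pedOf_decomp (g : Tors E Fbar l) (h5 : 5 ≤ l) (h6 : l.Coprime 6) (x : (pedOf (E := E) G g h5 h6).Cusp) :
    (pedOf (E := E) G g h5 h6).decomp x = lift G ⊥ := rfl

/-- An element of a decomposition group `G × 1` of the model has trivial `E_F[l] ⋊ {±1}`-component.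
[cite: Mochizuki2012, IUTchI §1 p.37] -/
theorem snd_eq_one_of_mem_pedOf_decomp {g : Tors E Fbar l} {h5 : 5 ≤ l} {h6 : l.Coprime 6}
    {x : (pedOf (E := E) G g h5 h6).Cusp} {k : G × Dih E Fbar l} (hk : k ∈ (pedOf (E := E) G g h5 h6).decomp x) :
    k.2 = 1 :=
  Subgroup.mem_bot.mp (mem_lift.mp hk)

/-- **The cusp inertia groups of the `K`-level model are trivial**: `I_x = (G × 1) ∩ (1 × (E_F[l] ⋊ {±1})) = 1`.
(HONEST LIMIT of the model: `Δ_X = E_F[l](F̄)` is finite, the cusps are labels.) [cite: Mochizuki2012, IUTchI §1 p.37] -/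
theorem pedOf_inertia_eq_bot (g : Tors E Fbar l) (h5 : 5 ≤ l) (h6 : l.Coprime 6) (x : (pedOf (E := E) G g h5 h6).Cusp) :
    (pedOf (E := E) G g h5 h6).inertia x = ⊥ := by
  rw [eq_bot_iff]
  intro k hk
  have h2 : (k : G × Dih E Fbar l).2 = 1 := snd_eq_one_of_mem_pedOf_decomp G hk.1
  have h1 : (k : G × Dih E Fbar l).1 = 1 := (FundamentalExtension.mem_geom _).mp hk.2
  exact Subgroup.mem_bot.mpr (Prod.ext h1 h2)

/-- Hence the `K`-level model does NOT satisfy the printed §1 claims `ArrowCoveringClaims` (it is abc-iut-L5-t1's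
`ArrowModel` that witnesses those). [cite: Mochizuki2012, IUTchI §1 p.38] -/
theorem not_arrowCoveringClaims_pedOf (g : Tors E Fbar l) (h5 : 5 ≤ l) (h6 : l.Coprime 6) :
    ¬ (pedOf (E := E) G g h5 h6).ArrowCoveringClaims :=
  (pedOf (E := E) G g h5 h6).not_arrowCoveringClaims_of_inertia_ε1_eq_bot (pedOf_inertia_eq_bot G g h5 h6 _)

end TorsionMonodromyModel

/-! ## At the re-geometrised initial Θ-datum: `tau_inertia` holds for `torsionMonodromyRegeom D₀` -/

namespace InitialThetaData

open TorsionMonodromyModel Literature.AnabelianGeometry.AbsoluteAnabelian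

variable {F K Fbar : Type u} [Field F] [NumberField F] [Field K] [NumberField K] [Algebra F K] [Field Fbar]
  [Algebra F Fbar] [Algebra K Fbar] {E : WeierstrassCurve F} [E.IsElliptic] {l : ℕ} {Pb : BadPlacePredicates K}

/-- The cusp inertia groups of the re-geometrised datum's §1 datum `pe = pedOf G_K g` are trivial.
[cite: Mochizuki2012, IUTchI §1 p.37] -/
theorem inertia_regeom_eq_bot (D₀ : InitialThetaData F K Fbar E l Pb) (x : D₀.regeom.geom.pe.Cusp) :
    D₀.regeom.geom.pe.inertia x = ⊥ := by
  rw [eq_bot_iff]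
  intro k hk
  have h2 : (k : galoisSubgroupOf F K Fbar × Dih E Fbar l).2 = 1 := Subgroup.mem_bot.mp (mem_lift.mp hk.1)
  have h1 : (k : galoisSubgroupOf F K Fbar × Dih E Fbar l).1 = 1 := (FundamentalExtension.mem_geom _).mp hk.2
  exact Subgroup.mem_bot.mpr (Prod.ext h1 h2)

/-- **`tau_inertia` AT THE MODEL** (GAP-LEDGER G-L5d5g6-1, the v-next law of `TorsionMonodromy`): for every cusp `x`
of `X̲_K` and every `k` in its inertia group, the `l`-torsion monodromy term of the re-geometrised datum kills
`embK k` — `τ(embK k) = (embK k).left = k.2.left = 1`, since `D_x = G_K × 1` in the model.  («the restricted map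
`D_x → Q` is trivial», [EtTh] Def 2.1, here at the level of `Δ_X^{ab} ⊗ 𝔽_l = E_F[l]`.)  HONEST LABEL: holds because
the model's inertia groups vanish — consistency evidence, not a discharge at the genuine curve.
[cite: Mochizuki2012, IUTchI Def 6.1 (v) p.158] -/
theorem tau_regeom_embK_eq_zero_of_mem_inertia (D₀ : InitialThetaData F K Fbar E l Pb)
    (x : D₀.regeom.geom.pe.Cusp) {k : D₀.regeom.geom.pe.PiC} (hk : k ∈ D₀.regeom.geom.pe.inertia x) :
    D₀.torsionMonodromyRegeom.tau (D₀.regeom.geom.embK k) = 0 := by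
  have h2 : (k : galoisSubgroupOf F K Fbar × Dih E Fbar l).2 = 1 := Subgroup.mem_bot.mp (mem_lift.mp hk.1)
  show Tors.pt (TorsionMonodromyModel.embK D₀.fixesTorsion_of_mem_galoisSubgroupOf k).left = 0
  rw [embK_left, h2, SemidirectProduct.one_left, Tors.pt_one]

/-- abc-iut-L5-d5's binder `hI` of `localArrowLaw_L1_of_torsionMonodromy` / `localArrowLaw_L1_local`, VERBATIM, at
the re-geometrised datum with `M := torsionMonodromyRegeom D₀`. [cite: Mochizuki2012, IUTchI Def 6.1 (v) p.158] -/
theorem tau_regeom_inertia_ε1 (D₀ : InitialThetaData F K Fbar E l Pb) :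
    ∀ k ∈ D₀.regeom.geom.pe.inertia D₀.regeom.geom.pe.ε1,
      D₀.torsionMonodromyRegeom.tau (D₀.regeom.geom.embK k) = 0 :=
  fun _ hk => D₀.tau_regeom_embK_eq_zero_of_mem_inertia _ hk

/-- **NON-VACUITY of the pair `{M : D.TorsionMonodromy, tau_inertia M}`** at the re-geometrised datum: a torsion
monodromy killing every cusp inertia group EXISTS on `D₀.regeom`. [cite: Mochizuki2012, IUTchI Def 6.1 (v) p.158] -/
theorem exists_torsionMonodromy_tau_inertia (D₀ : InitialThetaData F K Fbar E l Pb) :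
    ∃ M : D₀.regeom.TorsionMonodromy,
      ∀ x : D₀.regeom.geom.pe.Cusp, ∀ k ∈ D₀.regeom.geom.pe.inertia x, M.tau (D₀.regeom.geom.embK k) = 0 :=
  ⟨D₀.torsionMonodromyRegeom, D₀.tau_regeom_embK_eq_zero_of_mem_inertia⟩

/-- **For every initial Θ-datum there is one with the same arithmetic data (`V^bad_mod`, `V̲`) carrying a torsion
monodromy that kills the cusp inertia** — the binder pair `{Nonempty D.TorsionMonodromy, hI}` of the layer-5
certificate is JOINTLY satisfiable at genuine arithmetic data (KIT RULE non-vacuity for GAP G-L5d5g6-1).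
[cite: Mochizuki2012, IUTchI Def 6.1 (v) p.158] -/
theorem exists_initialThetaData_torsionMonodromy_tau_inertia (D₀ : InitialThetaData F K Fbar E l Pb) :
    ∃ D : InitialThetaData F K Fbar E l Pb, D.VbadMod = D₀.VbadMod ∧ D.V = D₀.V ∧
      ∃ M : D.TorsionMonodromy, ∀ x : D.geom.pe.Cusp, ∀ k ∈ D.geom.pe.inertia x, M.tau (D.geom.embK k) = 0 :=
  ⟨D₀.regeom, rfl, rfl, D₀.exists_torsionMonodromy_tau_inertia⟩

/-- The model's `τ` is LOCALLY CONSTANT on `Π_{C_F}` (it is the projection to the discrete normal factor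
`E_F[l](F̄)`): continuity of `τ` — the second classical input of the «(rel) + continuity ⇒ hI» route — also holds
in the model. [cite: Mochizuki2012, IUTchI Def 6.1 (v) p.158] -/
theorem isLocallyConstant_tau_regeom (D₀ : InitialThetaData F K Fbar E l Pb) :
    IsLocallyConstant D₀.torsionMonodromyRegeom.tau := by
  haveI := D₀.isAlgClosure
  haveI := D₀.isScalarTower
  haveI : NeZero l := ⟨D₀.l_prime.ne_zero⟩
  have hc : Continuous fun x : TorsionMonodromyModel.PiC F E Fbar l => x.left :=
    Literature.AnabelianGeometry.EtaleTheta.SettingModel.Semidirect.continuous_left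
      (TorsionMonodromyModel.PiC.isInducing E Fbar l)
  have hlc : IsLocallyConstant fun x : TorsionMonodromyModel.PiC F E Fbar l => x.left :=
    (IsLocallyConstant.iff_continuous _).mpr hc
  exact hlc.comp Tors.pt

/-- HONEST LIMIT, kernel-visible: the re-geometrised datum does NOT satisfy the printed §1 claims
`ArrowCoveringClaims` (its `I_{ε′}` is trivial), so the model witnesses `{M, hI}` jointly but NOT `{M, hA, hI}`;
`hA` is witnessed separately by abc-iut-L5-t1's `ArrowModel`. [cite: Mochizuki2012, IUTchI §1 p.38] -/
theorem not_arrowCoveringClaims_regeom (D₀ : InitialThetaData F K Fbar E l Pb) :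
    ¬ D₀.regeom.geom.pe.ArrowCoveringClaims :=
  D₀.regeom.geom.pe.not_arrowCoveringClaims_of_inertia_ε1_eq_bot (D₀.inertia_regeom_eq_bot _)

end InitialThetaData

end Literature.IUT.HodgeTheaters

end
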